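import Summits.CriticalPhenomena.PercolationContinuityZ3.Theorems.PercNearOneGluingNoHeavyLowerTailChampionStability
import Literature.Probability.Percolation.LonelyClusterExchange
import HarnessLib

/-!
# `NoHeavyLowerTail` (stmt-CriticalPhenomena-4575) — champion stability / merge stability for a RELAY partner
# is a THEOREM (BHK 2006 Thm. 1.5), and the cumulative isolation lemma for observers with relay neighbours

Seat `prim-cplus-literature` gen 12 (literature-prover), 2026-08-18.  For the PROVER seats (gen-swap / lead) to
land under `Theorems/` (`--supports stmt-CriticalPhenomena-4575`); this seat cannot write under `Theorems/`.
`μ = prodBernoulli w` on `Fin n`, relays `A`, level `j`, `π(z) = {a ∈ A : z ↔ a}`, `R_a = {|π(a)| ≤ j}`,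
champion `c` (`μ(R_a) ≤ μ(R_c)` for all `a ∈ A`).

* `championStabilityPair_of_mem` — the registered `stub_championStabilityPair` (CS₂) HOLDS whenever the second
  observer `y` is a relay (`y ∈ A`); indeed whenever `μ(R_y) ≤ μ(R_c)`, by the two-observer transfer
  `Literature.Probability.Percolation.twoObserver_le_of_lonelier` (BHK Thm. 1.5 with cardinality events).
* `mergeStability_of_mem` — the registered `stub_mergeStability` (MS) HOLDS for gluing `o` to a RELAY `v ∈ A`
  (pull-back of `μ_{w[s(o,v)↦1]}` along `insert s(o,v)`, word for word as in
  `ChampionStability.mergeStability_of_championStabilityPair`).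
* `cumulativeIsolation_of_relayNeighbours` — `stub_cumulativeIsolation` (CIL, all levels `j`, all `|A|`) HOLDS,
  UNCONDITIONALLY, for every observer `o ∉ A` all of whose positive-weight neighbours are relays (the
  deletion–contraction induction of `cumulativeIsolation_of_mergeStability` only ever glues `o` to such neighbours).
  Compare `cil_relayNeighbours_of_portComparison` (prim-gen-induct, conditional on the port comparison (⋆)).

What is NOT covered: MS for a NON-relay partner `v` that is lonelier than the champion (`μ(|π(v)| ≤ j) > μ(R_c)`);
this residual contains CIL itself (take `v` isolated).
-/

noncomputable section

namespace Summit.CriticalPhenomena.PercolationContinuityZ3.Theorems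

open MeasureTheory Set Literature.Probability.LatticeModels Literature.Probability.Percolation
open scoped Classical BigOperators

variable {n : ℕ}

/-- **CS₂ for a relay partner.**  The conclusion of `stub_championStabilityPair` for `y ∈ A` (any `x`, any
champion `c`), from `twoObserver_le_of_lonelier`. -/
theorem championStabilityPair_of_mem (n : ℕ) (w : Sym2 (Fin n) → unitInterval) (A : Finset (Fin n))
    (x y c : Fin n) (j : ℕ) (hy : y ∈ A) (_hc : c ∈ A)
    (hchamp : ∀ a ∈ A,
      (prodBernoulli w).real {ω : BondConfig (Fin n) | (A.filter fun z => ω ∈ openConn a z).card ≤ j} ≤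
        (prodBernoulli w).real {ω : BondConfig (Fin n) | (A.filter fun z => ω ∈ openConn c z).card ≤ j}) :
    (prodBernoulli w).real {ω : BondConfig (Fin n) |
        ω ∉ openConn c x ∧ ω ∉ openConn c y ∧
        1 ≤ (A.filter fun z => ω ∈ openConn x z ∨ ω ∈ openConn y z).card ∧
        (A.filter fun z => ω ∈ openConn x z ∨ ω ∈ openConn y z).card ≤ j} ≤
      (prodBernoulli w).real {ω : BondConfig (Fin n) |
        ω ∉ openConn c x ∧ ω ∉ openConn c y ∧ (A.filter fun z => ω ∈ openConn c z).card ≤ j} :=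
  twoObserver_le_of_lonelier w A x y c j (hchamp y hy)

open ChampionStability in
/-- **Merge stability for a relay partner.**  The conclusion of `stub_mergeStability` when the glued
neighbour `v` is a relay: pull back along `ω ↦ insert s(o,v) ω` and apply `championStabilityPair_of_mem`. -/
theorem mergeStability_of_mem (n : ℕ) (w : Sym2 (Fin n) → unitInterval) (A : Finset (Fin n))
    (o v c : Fin n) (j : ℕ) (_ho : o ∉ A) (hvo : v ≠ o) (hv : v ∈ A) (hc : c ∈ A) (hw : w s(o, v) = 0)
    (hchamp : ∀ a ∈ A,
      (prodBernoulli w).real {ω : BondConfig (Fin n) | (A.filter fun x => ω ∈ openConn a x).card ≤ j} ≤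
        (prodBernoulli w).real {ω : BondConfig (Fin n) | (A.filter fun x => ω ∈ openConn c x).card ≤ j}) :
    (prodBernoulli (Function.update w s(o, v) 1)).real {ω : BondConfig (Fin n) |
        1 ≤ (A.filter fun x => ω ∈ openConn o x).card ∧ (A.filter fun x => ω ∈ openConn o x).card ≤ j} ≤
      (prodBernoulli (Function.update w s(o, v) 1)).real {ω : BondConfig (Fin n) |
        (A.filter fun x => ω ∈ openConn c x).card ≤ j} := by
  have hov : o ≠ v := fun h => hvo h.symm
  set μ₁ := prodBernoulli (Function.update w s(o, v) 1) with hμ₁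
  set L₁ : Set (BondConfig (Fin n)) := {ω | 1 ≤ (A.filter fun x => ω ∈ openConn o x).card ∧
      (A.filter fun x => ω ∈ openConn o x).card ≤ j} with hL₁
  set R₁ : Set (BondConfig (Fin n)) := {ω | (A.filter fun x => ω ∈ openConn c x).card ≤ j} with hR₁
  set C : Set (BondConfig (Fin n)) := openConn o c with hC
  have hsplit : ∀ S : Set (BondConfig (Fin n)), μ₁.real S = μ₁.real (S ∩ C) + μ₁.real (S \ C) :=
    fun S => (measureReal_inter_add_sdiff (μ := μ₁) (s := S) (Set.toFinite C).measurableSet).symm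
  have hLC : L₁ ∩ C = R₁ ∩ C := by
    ext ω
    simp only [hL₁, hR₁, hC, mem_inter_iff, mem_setOf_eq]
    constructor
    · rintro ⟨⟨-, h2⟩, hoc⟩
      have hoc' : (openGraph ω).Reachable o c := hoc
      have heq : (A.filter fun x => ω ∈ openConn c x) = (A.filter fun x => ω ∈ openConn o x) := by
        refine Finset.filter_congr fun x _ => ⟨fun h => ?_, fun h => ?_⟩
        · exact hoc'.trans h
        · exact hoc'.symm.trans h
      rw [heq]
      exact ⟨h2, hoc⟩
    · rintro ⟨h2, hoc⟩
      have hoc' : (openGraph ω).Reachable o c := hoc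
      have heq : (A.filter fun x => ω ∈ openConn o x) = (A.filter fun x => ω ∈ openConn c x) := by
        refine Finset.filter_congr fun x _ => ⟨fun h => ?_, fun h => ?_⟩
        · exact hoc'.symm.trans h
        · exact hoc'.trans h
      rw [heq]
      refine ⟨⟨Finset.card_pos.2 ⟨c, Finset.mem_filter.2 ⟨hc, ?_⟩⟩, h2⟩, hoc⟩
      exact SimpleGraph.Reachable.refl c
  have hLoff : μ₁.real (L₁ \ C) = (prodBernoulli w).real {ω : BondConfig (Fin n) |
      ω ∉ openConn c o ∧ ω ∉ openConn c v ∧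
      1 ≤ (A.filter fun z => ω ∈ openConn o z ∨ ω ∈ openConn v z).card ∧
      (A.filter fun z => ω ∈ openConn o z ∨ ω ∈ openConn v z).card ≤ j} := by
    rw [hμ₁, real_update_one_eq w hw]
    congr 1
    ext ω
    simp only [hL₁, hC, mem_preimage, mem_sdiff, mem_setOf_eq]
    have hfilt : (A.filter fun x => insert s(o, v) ω ∈ openConn o x) =
        (A.filter fun z => ω ∈ openConn o z ∨ ω ∈ openConn v z) := by
      refine Finset.filter_congr fun x _ => ?_
      exact reachable_insert_left_iff ω hov x
    have hco : insert s(o, v) ω ∈ openConn o c ↔ (ω ∈ openConn c o ∨ ω ∈ openConn c v) := by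
      show (openGraph (insert s(o, v) ω)).Reachable o c ↔
        ((openGraph ω).Reachable c o ∨ (openGraph ω).Reachable c v)
      rw [SimpleGraph.reachable_comm]
      exact reachable_insert_to_left_iff ω hov c
    rw [hfilt, hco]
    tauto
  have hRoff : μ₁.real (R₁ \ C) = (prodBernoulli w).real {ω : BondConfig (Fin n) |
      ω ∉ openConn c o ∧ ω ∉ openConn c v ∧ (A.filter fun z => ω ∈ openConn c z).card ≤ j} := by
    rw [hμ₁, real_update_one_eq w hw]
    congr 1
    ext ω
    simp only [hR₁, hC, mem_preimage, mem_sdiff, mem_setOf_eq]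
    have hco : insert s(o, v) ω ∈ openConn o c ↔ (ω ∈ openConn c o ∨ ω ∈ openConn c v) := by
      show (openGraph (insert s(o, v) ω)).Reachable o c ↔
        ((openGraph ω).Reachable c o ∨ (openGraph ω).Reachable c v)
      rw [SimpleGraph.reachable_comm]
      exact reachable_insert_to_left_iff ω hov c
    rw [hco]
    constructor
    · rintro ⟨hcard, hnot⟩
      have hco' : ¬ (openGraph ω).Reachable c o := fun h => hnot (Or.inl h)
      have hcv' : ¬ (openGraph ω).Reachable c v := fun h => hnot (Or.inr h)
      have hfilt : (A.filter fun x => insert s(o, v) ω ∈ openConn c x) =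
          (A.filter fun z => ω ∈ openConn c z) := by
        refine Finset.filter_congr fun x _ => ?_
        exact reachable_insert_iff_of_not ω hov hco' hcv' x
      rw [hfilt] at hcard
      exact ⟨hco', hcv', hcard⟩
    · rintro ⟨hco', hcv', hcard⟩
      have hfilt : (A.filter fun x => insert s(o, v) ω ∈ openConn c x) =
          (A.filter fun z => ω ∈ openConn c z) := by
        refine Finset.filter_congr fun x _ => ?_
        exact reachable_insert_iff_of_not ω hov hco' hcv' x
      rw [hfilt]
      exact ⟨hcard, fun h => h.elim hco' hcv'⟩
  have key := championStabilityPair_of_mem n w A o v c j hv hc hchamp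
  rw [hsplit L₁, hsplit R₁, hLC, hLoff, hRoff]
  linarith

open MergeStability in
/-- **The cumulative isolation lemma for observers with relay neighbours (all levels, unconditional).**
If every positive-weight neighbour of the observer `o ∉ A` is a relay, then some relay `a ∈ A` has
`μ(1 ≤ N ≤ j) ≤ μ(|π(a)| ≤ j)` (`N = |π(o)|`) — the conclusion of `stub_cumulativeIsolation` for this
`(n, w, A, o, j)`.  Induction on the number of positive-weight pairs at `o` exactly as in
`cumulativeIsolation_of_mergeStability`, with `mergeStability_of_mem` supplying every gluing step. -/
theorem cumulativeIsolation_of_relayNeighbours (n : ℕ) (w : Sym2 (Fin n) → unitInterval)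
    (A : Finset (Fin n)) (o : Fin n) (j : ℕ) (hA : A.Nonempty) (ho : o ∉ A)
    (hrel : ∀ v : Fin n, v ≠ o → 0 < (w s(o, v) : ℝ) → v ∈ A) :
    ∃ a ∈ A,
      (prodBernoulli w).real {ω : BondConfig (Fin n) |
          1 ≤ (A.filter fun x => ω ∈ openConn o x).card ∧ (A.filter fun x => ω ∈ openConn o x).card ≤ j} ≤
        (prodBernoulli w).real {ω : BondConfig (Fin n) | (A.filter fun x => ω ∈ openConn a x).card ≤ j} := by
  suffices H : ∀ (m : ℕ) (w : Sym2 (Fin n) → unitInterval),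
      (Finset.univ.filter fun v : Fin n => v ≠ o ∧ 0 < (w s(o, v) : ℝ)).card = m →
      (∀ v : Fin n, v ≠ o → 0 < (w s(o, v) : ℝ) → v ∈ A) →
      ∃ a ∈ A, (prodBernoulli w).real {ω : BondConfig (Fin n) |
          1 ≤ (A.filter fun x => ω ∈ openConn o x).card ∧ (A.filter fun x => ω ∈ openConn o x).card ≤ j} ≤
        (prodBernoulli w).real {ω : BondConfig (Fin n) | (A.filter fun x => ω ∈ openConn a x).card ≤ j} from
    H _ w rfl hrel
  intro m
  induction m with
  | zero =>
    intro w hm _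
    obtain ⟨a, ha⟩ := hA
    refine ⟨a, ha, ?_⟩
    have hw : ∀ v : Fin n, v ≠ o → (w s(o, v) : ℝ) = 0 := by
      intro v hv
      by_contra hne
      have hpos : 0 < (w s(o, v) : ℝ) := lt_of_le_of_ne (w s(o, v)).2.1 (Ne.symm hne)
      have hmem : v ∈ (Finset.univ.filter fun v : Fin n => v ≠ o ∧ 0 < (w s(o, v) : ℝ)) :=
        Finset.mem_filter.2 ⟨Finset.mem_univ _, hv, hpos⟩
      rw [Finset.card_eq_zero] at hm
      rw [hm] at hmem
      exact Finset.notMem_empty v hmem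
    rw [real_L_eq_zero_of_isolated w A o j ho hw]
    exact measureReal_nonneg
  | succ m ih =>
    intro w hm hrelw
    obtain ⟨v, hv⟩ := Finset.card_pos.1
      (by omega : 0 < (Finset.univ.filter fun v : Fin n => v ≠ o ∧ 0 < (w s(o, v) : ℝ)).card)
    obtain ⟨-, hvo, hvpos⟩ := Finset.mem_filter.1 hv
    have hvA : v ∈ A := hrelw v hvo hvpos
    set e : Sym2 (Fin n) := s(o, v) with he
    set w₀ : Sym2 (Fin n) → unitInterval := Function.update w e 0 with hw₀
    set w₁ : Sym2 (Fin n) → unitInterval := Function.update w e 1 with hw₁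
    have hcount : (Finset.univ.filter fun u : Fin n => u ≠ o ∧ 0 < (w₀ s(o, u) : ℝ)).card = m := by
      have hset : (Finset.univ.filter fun u : Fin n => u ≠ o ∧ 0 < (w₀ s(o, u) : ℝ)) =
          (Finset.univ.filter fun u : Fin n => u ≠ o ∧ 0 < (w s(o, u) : ℝ)).erase v := by
        ext u
        simp only [Finset.mem_filter, Finset.mem_univ, true_and, Finset.mem_erase]
        by_cases huv : u = v
        · subst huv
          simp [hw₀, he]
        · have hne : s(o, u) ≠ e := by
            rw [he]
            intro h
            exact huv (Sym2.congr_right.1 h)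
          simp [hw₀, Function.update_of_ne hne, huv]
      rw [hset, Finset.card_erase_of_mem hv, hm]
      rfl
    -- the relay-neighbour hypothesis persists for `w₀` (weights only decrease)
    have hrel₀ : ∀ u : Fin n, u ≠ o → 0 < (w₀ s(o, u) : ℝ) → u ∈ A := by
      intro u huo hpos
      by_cases huv : u = v
      · exact huv ▸ hvA
      · have hne : s(o, u) ≠ e := by
          rw [he]
          intro h
          exact huv (Sym2.congr_right.1 h)
        have hwu : (w₀ s(o, u) : ℝ) = (w s(o, u) : ℝ) := by
          rw [hw₀, Function.update_of_ne hne]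
        exact hrelw u huo (hwu ▸ hpos)
    obtain ⟨a₀, ha₀, hCIL₀⟩ := ih w₀ hcount hrel₀
    obtain ⟨aStar, haStar, hchamp⟩ := exists_champion (prodBernoulli w₀) A hA j
    have hL₀ : (prodBernoulli w₀).real {ω : BondConfig (Fin n) |
        1 ≤ (A.filter fun x => ω ∈ openConn o x).card ∧ (A.filter fun x => ω ∈ openConn o x).card ≤ j} ≤
        (prodBernoulli w₀).real {ω : BondConfig (Fin n) | (A.filter fun x => ω ∈ openConn aStar x).card ≤ j} :=
      hCIL₀.trans (hchamp a₀ ha₀)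
    have hw₀e : w₀ s(o, v) = 0 := by simp [hw₀, he]
    have hMS' := mergeStability_of_mem n w₀ A o v aStar j ho hvo hvA haStar hw₀e hchamp
    have hw₁eq : Function.update w₀ s(o, v) 1 = w₁ := by
      rw [hw₀, hw₁, he, Function.update_idem]
    rw [hw₁eq] at hMS'
    refine ⟨aStar, haStar, ?_⟩
    have hp0 : 0 ≤ (w e : ℝ) := (w e).2.1
    have hp1 : (w e : ℝ) ≤ 1 := (w e).2.2
    rw [stub_oneBondDecomp_k15 n w e {ω : BondConfig (Fin n) |
        1 ≤ (A.filter fun x => ω ∈ openConn o x).card ∧ (A.filter fun x => ω ∈ openConn o x).card ≤ j},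
      stub_oneBondDecomp_k15 n w e {ω : BondConfig (Fin n) |
        (A.filter fun x => ω ∈ openConn aStar x).card ≤ j}]
    have h0 : (1 - (w e : ℝ)) * (prodBernoulli w₀).real {ω : BondConfig (Fin n) |
          1 ≤ (A.filter fun x => ω ∈ openConn o x).card ∧ (A.filter fun x => ω ∈ openConn o x).card ≤ j} ≤
        (1 - (w e : ℝ)) * (prodBernoulli w₀).real {ω : BondConfig (Fin n) |
          (A.filter fun x => ω ∈ openConn aStar x).card ≤ j} :=
      mul_le_mul_of_nonneg_left hL₀ (by linarith)
    have h1 : (w e : ℝ) * (prodBernoulli w₁).real {ω : BondConfig (Fin n) |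
          1 ≤ (A.filter fun x => ω ∈ openConn o x).card ∧ (A.filter fun x => ω ∈ openConn o x).card ≤ j} ≤
        (w e : ℝ) * (prodBernoulli w₁).real {ω : BondConfig (Fin n) |
          (A.filter fun x => ω ∈ openConn aStar x).card ≤ j} :=
      mul_le_mul_of_nonneg_left hMS' hp0
    exact add_le_add h0 h1

end Summit.CriticalPhenomena.PercolationContinuityZ3.Theorems

end
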